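import Literature.NumberTheory.EllipticCurves.PadicSigmaConstantFormulaProofs
import Literature.NumberTheory.EllipticCurves.PadicSigmaVariableChangeProofs
import Literature.NumberTheory.EllipticCurves.PadicWeierstrassZetaProofs
import Literature.RingTheory.FormalGroups.FunctionalEquationIntegrality
import HarnessLib

/-!
# The Mazur–Tate sigma pair from the `p`-adic Weierstrass zeta function:
# `σ = z·exp ∫(ζ - Dz/z)ω`, and the reduction of `mazur_tate_sigma_existsUnique` to the
# integrality of that exponential (Blakestad–Grant 2023, §2.2; proofs only)

Trunk T-NT-EC (Literature/NumberTheory/EllipticCurves). Blakestad–Grant construct the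
Mazur–Tate sigma function from their `p`-adic Weierstrass zeta function `ζ` (Thm. 2, tree:
`PadicWeierstrassZetaProofs.lean`, `η(zΛ' - Λ) = -(X - βz²)` for `ζ = Λ/z`) as

  `ζ̃ = ζ - Dz/z`,  `g = ∫ ζ̃ ω` (no constant term),  `σ = z · exp(g)`

(§2.2: "by construction, `ζ = D(log σ)`"), and their Thm. 1 is the statement that `exp(g)` has
integral coefficients (Hazewinkel's functional equation lemma, Cor. 6(c), applied through the
quotient by the canonical subgroup, Prop. 13). This file proves — as pure formal algebra — that
this `σ`, together with `c = -β`, is a Mazur–Tate sigma pair in the tree's sense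
(`IsMazurTateSigmaPair`, Mazur–Stein–Tate 2006 Thm. 1.3) GRANTED the integrality of `exp(g)`, and
thereby reduces the tree's named fact `mazur_tate_sigma_existsUnique` to exactly that
integrality statement:

* `sigmaG_X_mul_exp_subst` — for `zg' = Λ·ω/dz - 1`, `g(0) = 0`: the tree's `g`-series of
  `σ = z·exp(g)` (`sigmaG σ = zDσ/σ`) IS `Λ`; hence `satisfiesSigmaODE_X_mul_exp_subst` —
  **`σ = z·exp(g)` solves `x + c = -D(Dσ/σ)` with `c = -β`**;
* `rescale_neg_one_exp_subst_logInt` — `exp(g)` is even when `Λ` is (so `σ` is odd,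
  `isFormallyOdd_X_mul_exp_subst`);
* `isMazurTateSigmaPair_X_mul_exp_subst` — over `ℚ_p`: if moreover `exp(g) ∈ ℤ_p⟦z⟧` and `β ∈ ℤ_p`,
  then **`(z·exp(g), -β)` is a Mazur–Tate sigma pair**;
* `exists_even_padicWeierstrassZeta` — over `ℚ_p` (`p ≥ 3`, `a₁ = a₃ = 0`, `p`-integral,
  `‖w_{p-1}‖ = 1`): an EVEN integral zeta series `Λ ∈ 1 + z²ℤ_p⟦z⟧` with `β ∈ ℤ_p` exists
  (Blakestad–Grant Thm. 2 over `ℤ_p`, `padicInt_exists_padicWeierstrassZeta`, normalised by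
  `Λ ↦ Λ - Λ₁z`), and `exists_logInt` — its `g`;
* `mazur_tate_sigma_existsUnique_of_exp_integral` — **the named fact
  `WeierstrassCurve.mazur_tate_sigma_existsUnique` follows from: for every short `p`-integral
  model over `ℚ_p` (`p ≥ 5`, `‖Δ‖ = 1`, `‖w_{p-1}‖ = 1`) and every even integral zeta series `Λ`
  with its `g`, `exp(g) ∈ ℤ_p⟦z⟧`** — i.e. from Blakestad–Grant's Thm. 1 in its weakest form
  (via the tree's `mazur_tate_sigma_existsUnique_of_exists_shortModel`).

## Sources

* C. Blakestad, D. Grant, *On the universal `p`-adic sigma and Weierstrass zeta functions*,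
  J. Number Theory 249 (2023) (arXiv:1903.02480), §2.2 (the definitions of `ζ̃`, `g`, `σ̃ = exp g`,
  `σ = tσ̃`; "Our goal is to show that `σ(t)` … has coefficients in `R̂`"), Thm. 1, Thm. 2.
  [BlakestadGrant2023]
* B. Mazur, W. Stein, J. Tate, Doc. Math. Extra Vol. Coates (2006), Thm. 1.3, Rem. 1.4 (oddness
  and `σ = t + ⋯`). [MazurSteinTate2006]
* B. Mazur, J. Tate, *The `p`-adic sigma function*, Duke Math. J. 62 (1991), Thm. 3.1.

Pure proof file: no definitions, no named facts.
-/

noncomputable section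

open PowerSeries Literature.NumberTheory.EllipticCurves Literature.RingTheory.FormalGroups

namespace WeierstrassCurve

/-! ### Over a `ℚ`-algebra: `σ = z·exp(g)` with `zg' = Λω - 1` -/

section RatAlgebra

variable {A : Type*} [CommRing A] [Algebra ℚ A] (V : WeierstrassCurve A)

omit [Algebra ℚ A] in
/-- `sigmaShift (z·s) = s` (`σ/z` for `σ = z·s`). [folklore] -/
theorem _root_.Literature.NumberTheory.EllipticCurves.sigmaShift_X_mul (s : A⟦X⟧) :
    sigmaShift (X * s) = s := by
  ext n
  rw [coeff_sigmaShift, coeff_succ_X_mul]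

/-- **Integrating `(Λω - 1)/z`**: for `F ∈ A⟦z⟧` with `F(0) = 0` there is `g` with `g(0) = 0` and
`z·g' = F` (`g = Σ_{n≥1} Fₙ zⁿ/n`). [Blakestad–Grant 2023, §2.2 ("the integral of `ζ̃ω` … that has
no constant term")] [folklore] -/
theorem _root_.Literature.NumberTheory.EllipticCurves.exists_X_mul_derivative_eq {F : A⟦X⟧}
    (hF : constantCoeff F = 0) :
    ∃ g : A⟦X⟧, constantCoeff g = 0 ∧ X * d⁄dX A g = F := by
  refine ⟨PowerSeries.mk fun n => if n = 0 then 0 else algebraMap ℚ A (1 / n) * coeff n F, ?_, ?_⟩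
  · rw [← coeff_zero_eq_constantCoeff_apply, coeff_mk, if_pos rfl]
  · ext n
    rcases n with _ | k
    · rw [coeff_zero_X_mul, coeff_zero_eq_constantCoeff_apply, hF]
    · rw [coeff_succ_X_mul, coeff_derivative, coeff_mk, if_neg (Nat.succ_ne_zero k)]
      have : algebraMap ℚ A (1 / ((k + 1 : ℕ) : ℚ)) * ((k : A) + 1) = 1 := by
        rw [← map_natCast (algebraMap ℚ A) k, ← map_one (algebraMap ℚ A), ← map_add, ← map_mul]
        congr 1
        push_cast
        field_simp
      calc algebraMap ℚ A (1 / ((k + 1 : ℕ) : ℚ)) * coeff (k + 1) F * ((k : A) + 1)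
          = (algebraMap ℚ A (1 / ((k + 1 : ℕ) : ℚ)) * ((k : A) + 1)) * coeff (k + 1) F := by ring
        _ = coeff (k + 1) F := by rw [this, one_mul]

variable {V}

/-- **For `σ = z·exp(g)` with `zg' = Λ·ω/dz - 1` the series `g_σ = zDσ/σ` of the sigma equation is
`Λ`** (`Dσ/σ = Dz/z + Dg = η/z + (Λω - 1)η/z = Λ/z = ζ`: "by construction `ζ = D(log σ)`").
[Blakestad–Grant 2023, §2.2] [cite: BlakestadGrant2023, §2.2] -/
theorem sigmaG_X_mul_exp_subst {Λ g : A⟦X⟧} (hg0 : constantCoeff g = 0)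
    (hg : X * d⁄dX A g = Λ * V.formalOmega - 1) :
    V.sigmaG (X * (exp A).subst g) = Λ := by
  set s := (exp A).subst g with hs
  have hs0 : constantCoeff s = 1 := constantCoeff_exp_subst hg0
  have hs' : d⁄dX A s = s * d⁄dX A g := derivative_exp_subst hg0
  have hωs : constantCoeff (V.formalOmega * s) = 1 := by
    rw [map_mul, V.constantCoeff_formalOmega, hs0, one_mul]
  have hkey : s + X * d⁄dX A s = Λ * (V.formalOmega * s) := by
    rw [hs']
    linear_combination s * hg
  rw [sigmaG, sigmaShift_X_mul, hkey, mul_assoc, mul_invOfUnit _ _ (by rw [hωs, Units.val_one]),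
    mul_one]

/-- **`σ = z·exp(g)` solves the Mazur–Tate equation `x + c = -D(Dσ/σ)` with `c = -β`**, for
`η(zΛ' - Λ) = -(X - βz²)` (`Dζ = -x + β`, `ζ = Λ/z`), `zg' = Λω - 1`, `g(0) = 0` — in the tree's
pole-cleared encoding `SatisfiesSigmaODE`. [Blakestad–Grant 2023, §2.2 with Thm. 2;
Mazur–Stein–Tate 2006, Thm. 1.3] [cite: BlakestadGrant2023, Thm. 2] -/
theorem satisfiesSigmaODE_X_mul_exp_subst {Λ g : A⟦X⟧} {β : A}
    (hΛ : V.formalEta * (X * d⁄dX A Λ - Λ) = -(V.formalXMulSq - C β * X ^ 2))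
    (hg0 : constantCoeff g = 0) (hg : X * d⁄dX A g = Λ * V.formalOmega - 1) :
    V.SatisfiesSigmaODE (X * (exp A).subst g) (-β) := by
  rw [satisfiesSigmaODE_iff, sigmaG_X_mul_exp_subst hg0 hg, map_neg]
  have hωη := V.formalOmega_mul_formalEta
  linear_combination V.formalOmega * hΛ - (X * d⁄dX A Λ - Λ) * hωη

omit [Algebra ℚ A] in
/-- A series all of whose odd coefficients vanish is even. [folklore] -/
theorem _root_.Literature.NumberTheory.EllipticCurves.rescale_neg_one_eq_self_of_coeff_odd
    {f : A⟦X⟧} (h : ∀ n, Odd n → coeff n f = 0) : rescale (-1 : A) f = f := by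
  ext n
  rw [coeff_rescale]
  rcases Nat.even_or_odd n with hn | hn
  · rw [hn.neg_one_pow, one_mul]
  · rw [h n hn, mul_zero]

variable [V.IsCharNeTwoNF]

/-- `g` is even when `Λ` is: `zg' = Λω - 1` is even, so `n·gₙ = 0` for odd `n`. [folklore] -/
theorem rescale_neg_one_logInt {Λ g : A⟦X⟧} (hΛe : rescale (-1 : A) Λ = Λ)
    (hg : X * d⁄dX A g = Λ * V.formalOmega - 1) : rescale (-1 : A) g = g := by
  haveI := IsAddTorsionFree.of_module_rat (M := A)
  refine rescale_neg_one_eq_self_of_coeff_odd fun n hn => ?_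
  have he : rescale (-1 : A) (Λ * V.formalOmega - 1) = Λ * V.formalOmega - 1 := by
    rw [map_sub, map_mul, hΛe, V.rescale_neg_one_formalOmega, map_one]
  have h0 := coeff_eq_zero_of_rescale_neg_one_eq_self he hn
  rw [← hg] at h0
  obtain ⟨k, rfl⟩ : ∃ k, n = k + 1 := ⟨n - 1, by obtain ⟨j, rfl⟩ := hn; omega⟩
  rw [coeff_succ_X_mul, coeff_derivative] at h0
  have hu : IsUnit ((k : A) + 1) := by
    have : ((k : A) + 1) = algebraMap ℚ A ((k : ℚ) + 1) := by
      rw [map_add, map_natCast, map_one]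
    rw [this]
    exact (IsUnit.mk0 _ (by positivity)).map _
  exact (hu.mul_left_eq_zero).mp h0

/-- **`exp(g)` is even** (for `Λ` even). [Blakestad–Grant 2023, §2.2 ("`σ̃(t) = exp(g(t))`, which is
an even power series")] [cite: BlakestadGrant2023, §2.2] -/
theorem rescale_neg_one_exp_subst_logInt {Λ g : A⟦X⟧} (hΛe : rescale (-1 : A) Λ = Λ)
    (hg0 : constantCoeff g = 0) (hg : X * d⁄dX A g = Λ * V.formalOmega - 1) :
    rescale (-1 : A) ((exp A).subst g) = (exp A).subst g := by
  have hge := rescale_neg_one_logInt (V := V) hΛe hg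
  rw [← subst_neg_X_eq_rescale, subst_comp_subst_apply (HasSubst.of_constantCoeff_zero' hg0)
    (HasSubst.of_constantCoeff_zero' (by simp)), subst_neg_X_eq_rescale, hge]

/-- **`σ = z·exp(g)` is odd** in the Mazur–Tate sense (`σ(i(z)) = -σ(z)`, `i(z) = -z` for
`a₁ = a₃ = 0`). [Blakestad–Grant 2023, §2.2 ("`σ(t) = tσ̃(t)`, which is an odd power series");
Mazur–Stein–Tate 2006, Rem. 1.4] [cite: BlakestadGrant2023, §2.2] -/
theorem isFormallyOdd_X_mul_exp_subst {Λ g : A⟦X⟧} (hΛe : rescale (-1 : A) Λ = Λ)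
    (hg0 : constantCoeff g = 0) (hg : X * d⁄dX A g = Λ * V.formalOmega - 1) :
    V.IsFormallyOdd (X * (exp A).subst g) := by
  rw [V.isFormallyOdd_iff_rescale_of_isCharNeTwoNF, map_mul, rescale_neg_one_X,
    rescale_neg_one_exp_subst_logInt (V := V) hΛe hg0 hg, neg_mul]

end RatAlgebra

/-! ### Over `ℚ_p`: the Mazur–Tate pair, granted the integrality of `exp(g)` -/

section Padic

variable {p : ℕ} [Fact p.Prime] (W : WeierstrassCurve ℚ_[p])

/-- **The Mazur–Tate sigma pair from the zeta function, granted Blakestad–Grant's Thm. 1.** For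
`W/ℚ_p` with `a₁ = a₃ = 0`, an even zeta series `Λ` (`η(zΛ' - Λ) = -(X - βz²)`, `Λ(0) = 1`) with
`β ∈ ℤ_p`, and `g` with `zg' = Λω - 1`, `g(0) = 0`: IF `exp(g) ∈ ℤ_p⟦z⟧` then
**`(z·exp(g), -β)` is a Mazur–Tate sigma pair** (`σ = t + ⋯ ∈ tℤ_p⟦t⟧` odd, `c = -β ∈ ℤ_p`,
`x + c = -D(Dσ/σ)`). [Blakestad–Grant 2023, Thm. 1 with §2.2 and Thm. 2; Mazur–Stein–Tate 2006,
Thm. 1.3] [cite: BlakestadGrant2023, Thm. 1] -/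
theorem isMazurTateSigmaPair_X_mul_exp_subst [W.IsCharNeTwoNF] {Λ g : ℚ_[p]⟦X⟧} {β : ℚ_[p]}
    (hβ : ‖β‖ ≤ 1) (hΛe : rescale (-1 : ℚ_[p]) Λ = Λ)
    (hΛ : W.formalEta * (X * d⁄dX ℚ_[p] Λ - Λ) = -(W.formalXMulSq - C β * X ^ 2))
    (hg0 : constantCoeff g = 0) (hg : X * d⁄dX ℚ_[p] g = Λ * W.formalOmega - 1)
    (hint : IsPadicInt ((exp ℚ_[p]).subst g)) :
    W.IsMazurTateSigmaPair (X * (exp ℚ_[p]).subst g) (-β) where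
  constantCoeff_eq := by rw [map_mul, constantCoeff_X, zero_mul]
  coeff_one_eq := by
    rw [show (1 : ℕ) = 0 + 1 from rfl, coeff_succ_X_mul, coeff_zero_eq_constantCoeff,
      constantCoeff_exp_subst hg0]
  norm_coeff_le := fun n => by
    rcases n with _ | k
    · rw [coeff_zero_eq_constantCoeff, map_mul, constantCoeff_X, zero_mul, norm_zero]
      exact zero_le_one
    · rw [coeff_succ_X_mul]; exact isPadicInt_iff_coeff.mp hint k
  norm_const_le := by rwa [norm_neg]
  odd := isFormallyOdd_X_mul_exp_subst hΛe hg0 hg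
  ode := satisfiesSigmaODE_X_mul_exp_subst hΛ hg0 hg

/-- `rescale` commutes with `PowerSeries.map`. [folklore] -/
theorem _root_.Literature.NumberTheory.EllipticCurves.map_rescale {R S : Type*} [CommRing R]
    [CommRing S] (φ : R →+* S) (a : R) (f : R⟦X⟧) :
    PowerSeries.map φ (rescale a f) = rescale (φ a) (PowerSeries.map φ f) := by
  ext n
  rw [coeff_map, coeff_rescale, coeff_rescale, coeff_map, map_mul, map_pow]

variable [W.IsCharNeTwoNF] [W.IsIntegral ℤ_[p]]

/-- **An even integral zeta series over `ℚ_p`.** For `p ≥ 3` and a `p`-integral model with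
`a₁ = a₃ = 0` and unit Hasse coefficient `‖w_{p-1}‖ = 1` there are `β ∈ ℤ_p` and
`Λ ∈ 1 + z²ℤ_p⟦z⟧` EVEN with `η(zΛ' - Λ) = -(X - βz²)` (`Dζ = -x + β` for the odd `ζ = Λ/z`):
Blakestad–Grant's Thm. 2 over `ℤ_p` (`padicInt_exists_padicWeierstrassZeta`), base-changed and
normalised by `Λ ↦ Λ - Λ₁z` (which does not change `zΛ' - Λ`; the other odd coefficients vanish
since `(X - βz²)ω` is even). [Blakestad–Grant 2023, Thm. 2 ("odd under `t → -t`")]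
[cite: BlakestadGrant2023, Thm. 2] -/
theorem exists_even_padicWeierstrassZeta (hp2 : p ≠ 2) (hA : ‖coeff (p - 1) W.formalOmega‖ = 1) :
    ∃ β : ℚ_[p], ‖β‖ ≤ 1 ∧ ∃ Λ : ℚ_[p]⟦X⟧, IsPadicInt Λ ∧ constantCoeff Λ = 1 ∧
      rescale (-1 : ℚ_[p]) Λ = Λ ∧
      W.formalEta * (X * d⁄dX ℚ_[p] Λ - Λ) = -(W.formalXMulSq - C β * X ^ 2) := by
  set V := W.integralModel ℤ_[p] with hV
  have hVW : V.map PadicInt.Coe.ringHom = W := W.eq_map_integralModel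
  haveI : V.IsCharNeTwoNF := W.isCharNeTwoNF_integralModel
  have h1 : W.formalOmega = PowerSeries.map PadicInt.Coe.ringHom V.formalInvDiff := by
    rw [V.map_formalInvDiff, hVW, W.formalInvDiff_eq_formalOmega]
  have hAV : IsUnit (coeff (p - 1) V.formalInvDiff) := by
    rw [PadicInt.isUnit_iff]; rw [h1, coeff_map] at hA; exact_mod_cast hA
  obtain ⟨-, β, Λ, -, hΛ0, hΛ⟩ := padicInt_exists_padicWeierstrassZeta p hp2 V hAV
  -- base change to `ℚ_p` and normalise the linear coefficient away
  set a : ℚ_[p] := ((coeff 1 Λ : ℤ_[p]) : ℚ_[p]) with ha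
  set Λq : ℚ_[p]⟦X⟧ := PowerSeries.map PadicInt.Coe.ringHom Λ - C a * X with hΛq
  have hmap : W.formalEta * (X * d⁄dX ℚ_[p] (PowerSeries.map PadicInt.Coe.ringHom Λ) -
      PowerSeries.map PadicInt.Coe.ringHom Λ) = -(W.formalXMulSq - C (β : ℚ_[p]) * X ^ 2) := by
    have h := congrArg (PowerSeries.map PadicInt.Coe.ringHom) hΛ
    rw [map_mul, V.map_formalEta, map_sub, map_mul, map_X, powerSeries_map_derivative, map_neg,
      map_sub, V.map_formalXMulSq, map_mul, map_pow, map_X, map_C, hVW] at h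
    exact h
  have hΛq_eq : W.formalEta * (X * d⁄dX ℚ_[p] Λq - Λq) = -(W.formalXMulSq - C (β : ℚ_[p]) * X ^ 2) := by
    rw [← hmap, hΛq]
    have hd : d⁄dX ℚ_[p] (C a * X) = C a := by
      rw [Derivation.leibniz, derivative_C, derivative_X, smul_zero, add_zero, smul_eq_mul, mul_one]
    rw [map_sub (d⁄dX ℚ_[p]), hd]
    ring
  have hΛq0 : constantCoeff Λq = 1 := by
    rw [hΛq, map_sub, map_mul, constantCoeff_X, mul_zero, sub_zero, ← coeff_zero_eq_constantCoeff_apply,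
      coeff_map, coeff_zero_eq_constantCoeff_apply, hΛ0, map_one]
  have hΛq1 : coeff 1 Λq = 0 := by
    rw [hΛq, map_sub, coeff_map, coeff_C_mul, coeff_one_X, mul_one, ha]
    exact sub_eq_zero.mpr rfl
  -- evenness: `(n-1)Λₙ = -[zⁿ]((X - βz²)ω)` vanishes for odd `n`
  have hΛqe : rescale (-1 : ℚ_[p]) Λq = Λq := by
    refine rescale_neg_one_eq_self_of_coeff_odd fun n hn => ?_
    rcases Nat.lt_or_ge n 2 with hlt | hge
    · obtain ⟨j, rfl⟩ := hn
      have : j = 0 := by omega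
      subst this
      exact hΛq1
    · have hE : rescale (-1 : ℚ_[p]) ((W.formalXMulSq - C (β : ℚ_[p]) * X ^ 2) * W.formalOmega) =
          (W.formalXMulSq - C (β : ℚ_[p]) * X ^ 2) * W.formalOmega := by
        rw [map_mul, map_sub, map_mul, W.rescale_neg_one_formalXMulSq, W.rescale_neg_one_formalOmega,
          rescale_C_eq, show (2 : ℕ) = 2 * 1 from rfl, rescale_neg_one_X_pow_two_mul]
      have h0 := coeff_eq_zero_of_rescale_neg_one_eq_self hE hn
      -- `zΛ' - Λ = -(X - βz²)ω`
      have hωeq : X * d⁄dX ℚ_[p] Λq - Λq = -((W.formalXMulSq - C (β : ℚ_[p]) * X ^ 2) * W.formalOmega) := by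
        have hωη := W.formalOmega_mul_formalEta
        linear_combination W.formalOmega * hΛq_eq - (X * d⁄dX ℚ_[p] Λq - Λq) * hωη
      have hc := congrArg (coeff n) hωeq
      rw [map_neg, h0, neg_zero, map_sub] at hc
      obtain ⟨k, rfl⟩ : ∃ k, n = k + 1 := ⟨n - 1, by omega⟩
      rw [coeff_succ_X_mul, coeff_derivative] at hc
      have hk : ((k : ℚ_[p]) + 1 - 1) ≠ 0 := by
        rw [add_sub_cancel_right]; exact_mod_cast (show k ≠ 0 by omega)
      have : coeff (k + 1) Λq * ((k : ℚ_[p]) + 1 - 1) = 0 := by linear_combination hc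
      exact (mul_eq_zero.mp this).resolve_right hk
  refine ⟨β, PadicInt.norm_le_one β, Λq, ?_, hΛq0, hΛqe, hΛq_eq⟩
  exact (isPadicInt_map Λ).sub ((IsPadicInt.powerSeries_C (PadicInt.norm_le_one _)).mul IsPadicInt.powerSeries_X)

omit [W.IsCharNeTwoNF] [W.IsIntegral ℤ_[p]] in
/-- The `g` of a zeta series exists (`zg' = Λω - 1`, `g(0) = 0`). [Blakestad–Grant 2023, §2.2]
[folklore] -/
theorem exists_logInt {Λ : ℚ_[p]⟦X⟧} (hΛ0 : constantCoeff Λ = 1) :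
    ∃ g : ℚ_[p]⟦X⟧, constantCoeff g = 0 ∧ X * d⁄dX ℚ_[p] g = Λ * W.formalOmega - 1 :=
  exists_X_mul_derivative_eq (by rw [map_sub, map_mul, hΛ0, W.constantCoeff_formalOmega, map_one,
    mul_one, sub_self])

end Padic

/-! ### The named fact reduced to Blakestad–Grant's Theorem 1 -/

/-- **`mazur_tate_sigma_existsUnique` follows from the integrality of `exp ∫(ζ - Dz/z)ω`.** If for
every prime `p ≥ 5`, every short `p`-integral model `V/ℚ_p` with `‖Δ‖ = 1` and unit Hasse
coefficient `‖w_{p-1}‖ = 1`, every `β ∈ ℤ_p` and even `Λ ∈ 1 + zℤ_p⟦z⟧` with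
`η(zΛ' - Λ) = -(X - βz²)` (an integral odd solution `ζ = Λ/z` of `Dζ = -x + β`) and every `g`
with `g(0) = 0`, `zg' = Λω - 1`, the series `exp(g)` has coefficients in `ℤ_p` — Blakestad–Grant's
Thm. 1 ("`σ(t)` … has coefficients in `R̂`") specialised to single curves — then the tree's named
fact holds (Mazur–Stein–Tate 2006 Thm. 1.3: existence AND uniqueness of the Mazur–Tate pair for
globally minimal `W/ℚ` at good ordinary `p ≥ 5`; uniqueness and the reduction to short models are
theorems of the tree). [Blakestad–Grant 2023, Thm. 1, Thm. 2, Thm. 15; Mazur–Stein–Tate 2006,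
Thm. 1.3; Mazur–Tate 1991, Thm. 3.1] [cite: BlakestadGrant2023, Thm. 1] -/
theorem mazur_tate_sigma_existsUnique_of_exp_integral
    (H : ∀ (p : ℕ) [Fact p.Prime] (V : WeierstrassCurve ℚ_[p]) [V.IsIntegral ℤ_[p]] [V.IsShortNF],
      5 ≤ p → ‖V.Δ‖ = 1 → ‖coeff (p - 1) V.formalOmega‖ = 1 →
      ∀ (β : ℚ_[p]) (Λ g : ℚ_[p]⟦X⟧), ‖β‖ ≤ 1 → IsPadicInt Λ → constantCoeff Λ = 1 →
        rescale (-1 : ℚ_[p]) Λ = Λ →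
        V.formalEta * (X * d⁄dX ℚ_[p] Λ - Λ) = -(V.formalXMulSq - C β * X ^ 2) →
        constantCoeff g = 0 → X * d⁄dX ℚ_[p] g = Λ * V.formalOmega - 1 →
        IsPadicInt ((exp ℚ_[p]).subst g)) :
    mazur_tate_sigma_existsUnique := by
  refine mazur_tate_sigma_existsUnique_of_exists_shortModel fun p _ V _ _ hp _hΔ hA => ?_
  obtain ⟨β, hβ, Λ, hΛint, hΛ0, hΛe, hΛ⟩ := V.exists_even_padicWeierstrassZeta (by omega) hA
  obtain ⟨g, hg0, hg⟩ := V.exists_logInt hΛ0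
  exact ⟨_, _, V.isMazurTateSigmaPair_X_mul_exp_subst hβ hΛe hΛ hg0 hg
    (H p V hp _hΔ hA β Λ g hβ hΛint hΛ0 hΛe hΛ hg0 hg)⟩

end WeierstrassCurve
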